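import Summits.FinalStateConjecture.FinalStateConjecture.Theorems.SwallowTheDatumUniversalWitnessFamilyRegionOneAssembly
import Literature.Geometry.Lorentzian.CauchyDevelopmentGlobalHyperbolicityProofs
import Literature.Geometry.Lorentzian.CausalCurveLengthBound
import Literature.Geometry.Lorentzian.ConvergenceTransport
import Literature.Geometry.Lorentzian.CausalFutureCompactSet
import Literature.Geometry.Lorentzian.CausalityOpennessProofs

/-!
# Route StarvedNecks — crux `HonestFixedRadiusSettling`, line `far-field-surgery` (reshape v6,
# sheet burial): stub `stub_noFutureAccumulation`

The registered stub 2 of the line skeleton (crux item stmt-FinalStateConjecture-13550), proved: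
**static world-lines of bounded radius of the Schwarzschild exterior do not accumulate in a Cauchy
development into which the exterior is isometrically embedded.**

Setting: `χ` is a smooth, time-orientation preserving, isometric open embedding of the
Schwarzschild exterior `Kerr.spacetime M 0 (2M)` (Kruskal region I in ingoing Kerr–Schild
coordinates, carrier `Kerr.region 0 (2M)`) into a Cauchy development `𝒟` of data on a `3`-manifold
`X`, mapping the static slice `{t = 0}` (`staticTime M x = x⁰ − torH M ‖x̃‖`) into the Cauchy
hypersurface `ι(X) = range 𝒟.embed`.  If `pₙ` are points of region I with radii in `[r₁, r₂]`,
`r₁ > 2M`, and static times `t(pₙ) → +∞`, then `χ(pₙ)` converges to no point of `𝒟`.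

Proof (O'Neill 1983, Ch. 14, Lemma 14.13–14.14 and Lemma 14.40; Hawking–Ellis 1973, Prop. 6.6.6):
suppose `χ pₙ → z`.  Pick `z⁺` with `z ∈ I⁻(z⁺)` (a point slightly to the future on the integral
curve of the time orientation, `LorentzianMetric.exists_mem_nhds_mem_chronologicalFuture` for the
reversed orientation); `I⁻(z⁺)` is open (`isOpen_chronologicalPast_of_boundaryless`), so eventually
`χ pₙ ∈ I⁻(z⁺) ⊆ J⁻(z⁺)`.  The set `K = J⁻(z⁺) ∩ J⁺(ι X)` is compact
(`CauchyDevelopment.isCompact_causalPast_inter_causalFuture_range`) and `𝒟` is strongly causal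
(`CauchyDevelopment.isStronglyCausal`), so the future causal curve segments inside `K` have
uniformly bounded length `≤ B < ∞`
(`LorentzianMetric.IsStronglyCausal.exists_arcLength_le_of_isCompact`).  But the vertical (static
Killing) segment `s ↦ pₙ − t(pₙ) e₀ + s e₀`, `s ∈ [0, t(pₙ)]`, of region I is future timelike
(`isFutureTimelikeCurveOn_vert`), starts on the static slice and ends at `pₙ`; its `χ`-image is a
future causal curve (`IsFutureCausalCurveOn.comp_mdifferentiable`) inside `K` (its points lie in
`J⁺` of the foot, pushed into `J⁺(ι X)`, and in `J⁻(pₙ)`, pushed into `J⁻(χ pₙ) ⊆ J⁻(J⁻(z⁺)) = J⁻(z⁺)`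
by `image_causalFuture_subset` / `image_causalPast_subset` and `causalFuture_causalFuture_eq`), of
speed `√(1 − 2M/rₙ) ≥ √(1 − 2M/r₁) > 0` (chain rule, `χ^* g = g_{M,0}` and
`kerr_bilin_basisVector_zero_self`), hence of length `≥ t(pₙ) √(1 − 2M/r₁) → ∞` — contradiction.

No definitions, no named facts; standard axioms.

References: B. O'Neill, *Semi-Riemannian geometry*, Academic Press 1983, Ch. 14, Lemma 14.13–14.14
(pp. 407–408), Lemma 14.40 (p. 423); S. W. Hawking, G. F. R. Ellis, *The large scale structure of
space-time*, CUP 1973, §6.6, Prop. 6.6.6; MTW 1973, §31.4 (static observers of Schwarzschild).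
-/

-- the doubled `FinalStateConjecture` path component is the summit/problem naming scheme, not a mistake
set_option linter.dupNamespace false

noncomputable section

namespace Summit.FinalStateConjecture.FinalStateConjecture.Theorems.StarvedNecks.SheetBurial

open scoped Manifold ContDiff Topology
open Set Filter Function Literature.Geometry.Lorentzian
open Summit.FinalStateConjecture.FinalStateConjecture.Theorems.SwallowTheDatum.UniversalWitnessFamily
  (torH staticTime vert ksTime)
open Summit.FinalStateConjecture.FinalStateConjecture.Theorems.SwallowTheDatum.UniversalWitnessFamily
  (staticTime_vert vert_add vert_zero isFutureTimelikeCurveOn_vert mem_causalPast_vert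
    mem_causalFuture_vert mdifferentiableAt_vert two_mul_lt_spatialNorm spatialNorm_vert
    kerr_bilin_basisVector_zero_self)

/-- **Stub `stub_noFutureAccumulation`** (registered signature, line `far-field-surgery`, crux item
stmt-FinalStateConjecture-13550): STATIC WORLD-LINES OF BOUNDED RADIUS DO NOT ACCUMULATE IN A CAUCHY
DEVELOPMENT.  Let `χ` embed the Schwarzschild exterior `Kerr.spacetime M 0 (2M)` (region I)
smoothly, isometrically, openly and time-orientedly into a Cauchy development `𝒟`, mapping the
static slice `{t = 0}` into the Cauchy hypersurface `ι(X)`.  If `pₙ` are points of region I with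
radii in `[r₁, r₂]`, `r₁ > 2M`, and static times `t(pₙ) → +∞`, then `χ(pₙ)` has no limit in `𝒟`:
a limit `z` would put, for large `n`, the `χ`-image of the vertical static segment from the slice
point `pₙ − t(pₙ) e₀` to `pₙ` — a future causal curve of length `≥ t(pₙ) √(1 − 2M/r₁) → ∞` — inside
the compact set `J⁺(ι X) ∩ J⁻(z⁺)` (`z ∈ I⁻(z⁺)`) of the strongly causal spacetime `𝒟`, whose causal
curves have uniformly bounded length. O'Neill 1983, Ch. 14, Lemma 14.13–14.14 and Lemma 14.40;
Hawking–Ellis 1973, §6.6, Prop. 6.6.6.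
[cite: ONeillSemiRiemannian1983, Ch. 14, Lemma 14.13–14.14 (pp. 407–408)] -/
theorem stub_noFutureAccumulation :
    ∀ [Kerr.Facts] (M : ℝ) (hM : 0 < M)
      (X : Type) [TopologicalSpace X] [ChartedSpace E3 X] [IsManifold (𝓡 3) ∞ X]
      [T2Space X] [SecondCountableTopology X] [ConnectedSpace X]
      (D : InitialDataSet (𝓡 3) X) (𝒟 : CauchyDevelopment D)
      (χ : (Kerr.spacetime M 0 (Kerr.rPlus M 0) hM.le).carrier → 𝒟.carrier),
      ContMDiff (𝓡 4) (𝓡 4) ∞ χ → Topology.IsOpenEmbedding χ →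
      (Kerr.spacetime M 0 (Kerr.rPlus M 0) hM.le).metric.IsIsometricImmersion
        𝒟.metric.toPseudoRiemannianMetric χ →
      (Kerr.spacetime M 0 (Kerr.rPlus M 0) hM.le).timeOrientation.PreservesTimeOrientation χ
        𝒟.timeOrientation →
      χ '' {p | staticTime M p.1 = 0} ⊆ Set.range 𝒟.embed →
      ∀ (p : ℕ → Kerr.region 0 (Kerr.rPlus M 0)) (r₁ r₂ : ℝ), 2 * M < r₁ →
        (∀ n, r₁ ≤ E4.spatialNorm (p n).1 ∧ E4.spatialNorm (p n).1 ≤ r₂) →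
        Tendsto (fun n ↦ staticTime M (p n).1) atTop atTop →
        ∀ z : 𝒟.carrier, ¬ Tendsto (fun n ↦ χ (p n)) atTop (𝓝 z) := by
  intro _ M hM X _ _ _ _ _ _ D 𝒟 χ hχs hχo hiso hτ hslice p r₁ r₂ hr₁ hbd htime z hz
  -- notation
  set g := 𝒟.metric with hg
  set T := 𝒟.timeOrientation with hT
  have hχd : MDifferentiable (𝓡 4) (𝓡 4) χ := hχs.mdifferentiable (by simp)
  have htwo : (2 : ℕ∞ω) ≤ ∞ := WithTop.coe_le_coe.mpr le_top
  -- (a) a point `zp` with `z ∈ I⁻(zp)`; eventually `χ (p n) ∈ I⁻(zp)`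
  obtain ⟨zp, -, hzp⟩ := LorentzianMetric.exists_mem_nhds_mem_chronologicalFuture
    (g := g) (τ := T.reverse) (by exact_mod_cast le_top) (univ_mem : (univ : Set 𝒟.carrier) ∈ 𝓝 z)
  have hopen : IsOpen (g.chronologicalPast T {zp}) :=
    LorentzianMetric.isOpen_chronologicalPast_of_boundaryless g T {zp}
  have hev : ∀ᶠ n in atTop, χ (p n) ∈ g.chronologicalPast T {zp} := hz (hopen.mem_nhds hzp)
  -- (b) the compact set `K = J⁻(zp) ∩ J⁺(ι X)`
  set K := g.causalPast T {zp} ∩ g.causalFuture T (range 𝒟.embed) with hK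
  have hKc : IsCompact K := 𝒟.isCompact_causalPast_inter_causalFuture_range zp
  -- (c) the uniform length bound
  obtain ⟨B, hBtop, hB⟩ := LorentzianMetric.IsStronglyCausal.exists_arcLength_le_of_isCompact T
    (by exact_mod_cast le_top) 𝒟.isStronglyCausal hKc
  -- (d) the speed bound `c = √(1 - 2M/r₁)`
  have hr₁0 : 0 < r₁ := by linarith
  have hcr : 2 * M / r₁ < 1 := by rw [div_lt_one hr₁0]; exact hr₁
  set c : ℝ := Real.sqrt (1 - 2 * M / r₁) with hc
  have hc0 : 0 < c := Real.sqrt_pos.2 (by linarith)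
  -- (e) the key estimate for each `n`
  have key : ∀ n, χ (p n) ∈ g.chronologicalPast T {zp} → 0 ≤ staticTime M (p n).1 →
      ENNReal.ofReal (c * staticTime M (p n).1) ≤ B := by
    intro n hn ht0
    generalize hx : p n = x at hn ht0 ⊢
    generalize htdef : staticTime M x.1 = t at ht0 ⊢
    -- the foot of the vertical segment lies on the static slice
    have hfoot0 : staticTime M (vert x (-t)).1 = 0 := by
      rw [staticTime_vert, htdef]; ring
    have hfootS : χ (vert x (-t)) ∈ range 𝒟.embed := hslice ⟨vert x (-t), hfoot0, rfl⟩
    have hγt : vert (vert x (-t)) t = x := by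
      rw [vert_add, neg_add_cancel, vert_zero]
    -- the vertical segment is future timelike, its image future causal
    have hγS : (Kerr.smoothMetric M 0 (Kerr.rPlus M 0)).IsFutureTimelikeCurveOn (ksTime hM.le)
        (vert (vert x (-t))) (Icc 0 t) :=
      isFutureTimelikeCurveOn_vert hM _ _
    have hγD : g.IsFutureCausalCurveOn T (χ ∘ vert (vert x (-t))) (Icc 0 t) :=
      hγS.isFutureCausalCurveOn.comp_mdifferentiable hχd hτ hiso.2
    -- the image segment lies in `K`
    have hinK : ∀ s ∈ Icc (0 : ℝ) t, (χ ∘ vert (vert x (-t))) s ∈ K := by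
      intro s hs
      refine ⟨?_, ?_⟩
      · -- `J⁻(zp)`
        have h1 : vert (vert x (-t)) s ∈
            (Kerr.smoothMetric M 0 (Kerr.rPlus M 0)).causalPast (ksTime hM.le) {x} := by
          have h := mem_causalPast_vert hM (vert (vert x (-t)) s) (s := t - s) (by linarith [hs.2])
          rwa [vert_add, show s + (t - s) = t by ring, hγt] at h
        have h2 : χ (vert (vert x (-t)) s) ∈ g.causalPast T {χ x} :=
          LorentzianMetric.causalFuture_mono (Set.image_singleton (f := χ) (a := x)).subset
            (LorentzianMetric.image_causalPast_subset hχd hτ hiso.2 {x} (mem_image_of_mem χ h1))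
        have h3 : χ x ∈ g.causalPast T {zp} :=
          LorentzianMetric.chronologicalFuture_subset_causalFuture _ _ _ hn
        have h4 : g.causalPast T {χ x} ⊆ g.causalPast T {zp} := by
          have h5 := LorentzianMetric.causalFuture_mono (g := g) (τ := T.reverse)
            (singleton_subset_iff.2 h3)
          rwa [show g.causalFuture T.reverse (g.causalPast T {zp}) = g.causalPast T {zp} from
            LorentzianMetric.causalFuture_causalFuture_eq htwo {zp}] at h5
        exact h4 h2
      · -- `J⁺(ι X)`
        have h1 : vert (vert x (-t)) s ∈
            (Kerr.smoothMetric M 0 (Kerr.rPlus M 0)).causalFuture (ksTime hM.le) {vert x (-t)} :=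
          mem_causalFuture_vert hM _ hs.1
        have h2 : χ (vert (vert x (-t)) s) ∈ g.causalFuture T {χ (vert x (-t))} :=
          LorentzianMetric.causalFuture_mono (Set.image_singleton (f := χ) (a := vert x (-t))).subset
            (LorentzianMetric.image_causalFuture_subset hχd hτ hiso.2 {vert x (-t)}
              (mem_image_of_mem χ h1))
        exact LorentzianMetric.causalFuture_mono (singleton_subset_iff.2 hfootS) h2
    -- the length bound from above
    have hlen := hB (χ ∘ vert (vert x (-t))) 0 t ht0 hγD hinK
    -- the speed of the image segment is at least `c`
    have hspeed : ∀ s : ℝ, c ≤ g.speed (χ ∘ vert (vert x (-t))) s := by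
      intro s
      obtain ⟨hd, hv⟩ := mdifferentiableAt_vert (vert x (-t)) s
      -- chain rule
      have hcomp := mfderiv_comp s (hχd (vert (vert x (-t)) s)) hd
      have hvel : velocity (𝓡 4) (χ ∘ vert (vert x (-t))) s =
          mfderiv (𝓡 4) (𝓡 4) χ (vert (vert x (-t)) s) (E4.basisVector 0) := by
        rw [← hv]
        exact congrArg (fun L ↦ L (1 : ℝ)) hcomp
      -- the isometry and the Schwarzschild value `g(e₀, e₀) = -1 + 2M/r`
      have hr : 2 * M < E4.spatialNorm (vert (vert x (-t)) s).1 := two_mul_lt_spatialNorm hM.le _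
      have hr0 : E4.spatialNorm (vert (vert x (-t)) s).1 ≠ 0 := by linarith
      have hkey : g.val (χ (vert (vert x (-t)) s))
          (mfderiv (𝓡 4) (𝓡 4) χ (vert (vert x (-t)) s) (E4.basisVector 0))
          (mfderiv (𝓡 4) (𝓡 4) χ (vert (vert x (-t)) s) (E4.basisVector 0)) =
          -1 + 2 * M / E4.spatialNorm (vert (vert x (-t)) s).1 := by
        have h := congrArg (fun b ↦ b (E4.basisVector 0) (E4.basisVector 0))
          (hiso.2 (vert (vert x (-t)) s))
        simp only [pullbackBilin_apply] at h
        rw [← kerr_bilin_basisVector_zero_self hr0]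
        exact h
      have hry : E4.spatialNorm (vert (vert x (-t)) s).1 = E4.spatialNorm x.1 := by
        rw [spatialNorm_vert, spatialNorm_vert]
      have hr1 : r₁ ≤ E4.spatialNorm (vert (vert x (-t)) s).1 := by
        rw [hry, ← hx]; exact (hbd n).1
      have hlt : 2 * M / E4.spatialNorm (vert (vert x (-t)) s).1 < 1 := by
        rw [div_lt_one (by linarith)]; exact hr
      have hle : 2 * M / E4.spatialNorm (vert (vert x (-t)) s).1 ≤ 2 * M / r₁ :=
        div_le_div_of_nonneg_left (by linarith) hr₁0 hr1
      rw [PseudoRiemannianMetric.speed_def, hvel, show (χ ∘ vert (vert x (-t))) s =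
        χ (vert (vert x (-t)) s) from rfl]
      rw [show g.toPseudoRiemannianMetric.val = g.val from rfl, hkey, abs_of_neg (by linarith), hc]
      apply Real.sqrt_le_sqrt
      linarith
    -- the length from below
    have hlow : ENNReal.ofReal (c * t) ≤ g.arcLength (χ ∘ vert (vert x (-t))) 0 t := by
      calc ENNReal.ofReal (c * t) = ∫⁻ _ in Icc (0 : ℝ) t, ENNReal.ofReal c := by
            rw [MeasureTheory.setLIntegral_const, Real.volume_Icc, sub_zero,
              ← ENNReal.ofReal_mul hc0.le]
        _ ≤ ∫⁻ s in Icc (0 : ℝ) t, ENNReal.ofReal (g.speed (χ ∘ vert (vert x (-t))) s) :=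
            MeasureTheory.setLIntegral_mono' measurableSet_Icc
              (fun s _ ↦ ENNReal.ofReal_le_ofReal (hspeed s))
        _ = g.arcLength (χ ∘ vert (vert x (-t))) 0 t := rfl
    exact hlow.trans hlen
  -- (f) conclusion: `c · t(p n) → ∞` contradicts the uniform bound `B < ⊤`
  have hevt : ∀ᶠ n in atTop, B.toReal + 1 ≤ c * staticTime M (p n).1 :=
    (htime.eventually_ge_atTop ((B.toReal + 1) / c)).mono fun n hn ↦ by
      rwa [div_le_iff₀ hc0, mul_comm] at hn
  have hev0 : ∀ᶠ n in atTop, 0 ≤ staticTime M (p n).1 := htime.eventually_ge_atTop 0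
  obtain ⟨n, hn, hnt, hn0⟩ := (hev.and (hevt.and hev0)).exists
  have h := key n hn hn0
  have hB' : B = ENNReal.ofReal B.toReal := (ENNReal.ofReal_toReal hBtop.ne).symm
  rw [hB'] at h
  have h' := (ENNReal.ofReal_le_ofReal_iff ENNReal.toReal_nonneg).1 h
  linarith

end Summit.FinalStateConjecture.FinalStateConjecture.Theorems.StarvedNecks.SheetBurial

end
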